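import Literature.NumberTheory.LFunctions.Zhang2022.RepairVerdictAssembly
import Literature.NumberTheory.LFunctions.Zhang2022.RepairCrossFormSection10H2

/-!
# The structural verdict in the transcribed §10 currency: `¬ MainOrderT θ (C₂₃₂(θ))`, `trueNeed(θ) ≤ C₂₃₂(θ)`

Trunk T-ANT (NumberTheory/LFunctions). Repair rung F-S1R (D-0077) for Y. Zhang, *Discrete mean estimates and
the Landau–Siegel zero*, arXiv:2211.02515v1 [Zhang2022LandauSiegel] — **an unrefereed manuscript under
adjudication; nothing here asserts any of its claims.** Companion of `RepairVerdictAssembly` (the verdict of record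
`Repair.not_repairable_true_need : ∀ θ, AdmissibleTheta θ → ¬ (C232S θ · C233T θ < ‖dSumS θ‖²)`, cross slot in
FORM currency `dSumS`) and of `RepairCrossFormSection10H2` (K-S3 faithfulness `dSumS θ = dprimeT θ + dfrakT θ` on
the face `ν₂ = 1/2`): the same verdict with the cross term read as the TRANSCRIBED `𝔡′(θ) + 𝔡(θ)` of (10.17)
(`RepairSection10Theta.dprimeT/dfrakT/MainOrderT/trueNeedT`), i.e. in the currency of the cell's numerical
T-true tables —

* `not_mainOrderT_in_class` : on the face, `¬ MainOrderT θ (C232S θ)` — the §2 endgame criterion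
  `C₂₃₂(θ)·C₂₃₃(θ) < |𝔡′(θ)+𝔡(θ)|²` fails with `C₂₃₂(θ) = 𝔅(𝔤_θ)` (K-S1 + K-S2's functional of record);
* `not_mainOrderT_transcribed_in_class` : the same with `C₂₃₂` read as the transcribed `C232D θ + 2 Re discS θ`;
* `trueNeedT_le_C232S` : `trueNeedT θ = |𝔡′+𝔡|²/C₂₃₃ ≤ C₂₃₂(θ)` — the need never exceeds the constant of the
  same design (the Cauchy–Schwarz wall in the ratio currency; at `θ₀`: `0.0110 ≤ C232S θ₀`, cf. the certified
  `trueNeedT_theta0_lt` and `C232c ≥ 0.0249`);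
* at the printed design: `not_mainOrderContradiction_C232S_theta0 : ¬ MainOrderContradiction (C232S θ₀) C233`
  (`Section2MainOrder`'s own predicate, via `mainOrderT_theta0_iff`).

Elementary consequences; no new `Prop` facts, no statement about Theorems 1–2.
-/

noncomputable section

open Complex Real ComplexConjugate

namespace Literature.NumberTheory.LFunctions.Zhang2022

namespace Repair

variable {θ : Theta}

/-- `C₂₃₃(θ) > 0` on the class (`= 16σ/π + 176π/(3σ)`, `σ > 0`). [cite: Zhang2022LandauSiegel, §18 proof of (2.33) p.100] -/
theorem C233T_pos (h : AdmissibleTheta θ) : 0 < C233T θ := by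
  obtain ⟨h21, h0, h1⟩ := h.assembly_bounds
  have hσ := θ.sig_pos h21
  rw [C233T_eq h21 h0 h1]
  positivity

/-- **the §2 endgame criterion fails in class, transcribed currency**: for every admissible design on the face
`ν₂ = 1/2`, `¬ (C232S θ · C₂₃₃(θ) < |𝔡′(θ) + 𝔡(θ)|²)` with `𝔡′, 𝔡` the transcribed (10.12)–(10.17).
[cite: Zhang2022LandauSiegel, §2 (2.18), Props. 2.4–2.6; §10 (10.17)] -/
theorem not_mainOrderT_in_class (h : AdmissibleTheta θ) (hface : θ.nu2 = 1 / 2) : ¬ MainOrderT θ (C232S θ) := by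
  unfold MainOrderT
  rw [Complex.normSq_eq_norm_sq, ← dSumS_eq_section10 h hface]
  exact not_repairable_true_need θ h

/-- the same with the (2.32)-constant read as the transcribed §18 functional plus the two-sided `𝔠₃`-slot
`2 Re discS(θ)` (`RepairVerdictAssembly.not_repairable_true_need_transcribed`).
[cite: Zhang2022LandauSiegel, §2 (2.18); §10 (10.17); §18 (18.1)] -/
theorem not_mainOrderT_transcribed_in_class (h : AdmissibleTheta θ) (hface : θ.nu2 = 1 / 2) :
    ¬ MainOrderT θ (C232D θ + 2 * (discS θ).re) := by
  unfold MainOrderT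
  rw [Complex.normSq_eq_norm_sq, ← dSumS_eq_section10 h hface]
  exact not_repairable_true_need_transcribed θ h

/-- **the need never exceeds the constant**: `trueNeedT θ = |𝔡′+𝔡|²(θ)/C₂₃₃(θ) ≤ C232S θ` for every admissible
design on the face `ν₂ = 1/2` (Cauchy–Schwarz in the ratio currency of the cell's T-true tables).
[cite: Zhang2022LandauSiegel, §2 (2.18), (2.32)–(2.33); §10 (10.17)] -/
theorem trueNeedT_le_C232S (h : AdmissibleTheta θ) (hface : θ.nu2 = 1 / 2) : trueNeedT θ ≤ C232S θ := by
  have hC := C233T_pos h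
  have hle := normSq_dSumS_le θ h
  rw [dSumS_eq_section10 h hface, ← Complex.normSq_eq_norm_sq] at hle
  unfold trueNeedT
  rwa [div_le_iff₀ hC]

/-- at the printed design: `Section2MainOrder.MainOrderContradiction (C232S θ₀) C233` fails — the §2 endgame
cannot close at `θ₀` with the structural (2.32)-constant, by Cauchy–Schwarz alone (no numerics).
[cite: Zhang2022LandauSiegel, §2 (2.18), Props. 2.4–2.6, (2.32)–(2.33)] -/
theorem not_mainOrderContradiction_C232S_theta0 : ¬ MainOrderContradiction (C232S theta0) C233 := by
  rw [← mainOrderT_theta0_iff]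
  exact not_mainOrderT_in_class admissible_theta0 (by norm_num [theta0])

/-- at the printed design, in numbers the tree already certifies: `trueNeedT θ₀ ≤ C232S θ₀` — consistent with
`trueNeedT_theta0_lt : trueNeedT θ₀ < 0.011026` and the certified (2.32)-side constants `≥ 0.0249`.
[cite: Zhang2022LandauSiegel, §2 (2.32)–(2.33); §10 (10.17)] -/
theorem trueNeedT_theta0_le_C232S : trueNeedT theta0 ≤ C232S theta0 :=
  trueNeedT_le_C232S admissible_theta0 (by norm_num [theta0])

end Repair

end Literature.NumberTheory.LFunctions.Zhang2022
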